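import Summits.CriticalPhenomena.PercolationContinuityZ3.Theses.PercTorusSliceFilling
import Summits.CriticalPhenomena.PercolationContinuityZ3.Theorems.PercTorusSliceFillingThinClusterTransportGlue
import HarnessLib

/-!
# Crux `PercTorusSliceFilling.TorusNonProliferation` (stmt-CriticalPhenomena-5415) — typed split
# by the sf-volume / giant dichotomy (crux-strategist s1, 2026-08-17)

Support file for item `stmt-CriticalPhenomena-5415`; lands with `--supports stmt-CriticalPhenomena-5415`.

Write `T_n = (ℤ/nℤ)³`, `P = P_{T_n,p_c(ℤ³)}`, `C(x) = openCluster ω x`, call a set `S ⊆ T_n`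
slice-filling (sf) if `∃ i, ∀ t : ZMod n, ∃ y ∈ S, y i = t`, and put
`N_sf := #{sf open clusters}`, `V_sf := #{x : C(x) sf}` (total sf volume), `K_max := max_x |C(x)|`.
The crux says: `∀ δ > 0 ∃ M ∀ n ≥ 3, P(M ≤ N_sf) ≤ δ`.

We split it along the two thresholds `V_sf ≷ ε n³` and `K_max ≷ η n³` into three statements, each
spelled out over the route's vocabulary (no new definitions):

* (J) `SfFewWithGiant` — many sf clusters together WITH an `η n³`-giant are rare:
  `∀ δ>0 ∀ η>0 ∃ M ∀ n ≥ 3, P(M ≤ N_sf ∧ ∃ x, η n³ ≤ |C(x)|) ≤ δ`.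
  Dominated by the route's other crux: `NoCriticalTorusGiant → (J)`
  (`sfFewWithGiant_of_noCriticalTorusGiant` below).
* (W) `SfVolumeForcesGiant` — macroscopic sf volume WITHOUT a giant is rare:
  `∀ δ>0 ∀ ε>0 ∃ η>0 ∃ N ∀ n ≥ N, P(ε n³ ≤ V_sf ∧ ∀ x, |C(x)| < η n³) ≤ δ`.
  This is the dimension-free part (vacuous above six dimensions, where `V_sf = o(n^d)`), a
  finite-volume uniqueness statement for the torus; it is exactly what the route's deciding
  theorem consumes of the crux (see the census, `Cruxes/TorusNonProliferation/STRATEGY-CENSUS.md`).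
* (D) `SfManyHaveVolume` — many sf clusters with SMALL total sf volume are rare:
  `∀ δ>0 ∃ ε>0 ∃ M ∀ n ≥ 3, P(M ≤ N_sf ∧ V_sf < ε n³) ≤ δ`.
  The residue: trivially implied by the crux, and through it by `ThinClusterRarity`
  (`ThinClusterTransport`) and by `PercAnnulusCrossing.CritAnnulusNonCrossing` (p160739); it carries
  the crux's `d = 3`-specific (hyperscaling) content.

Main results:
* `TorusNonProliferation_of_subs : (J) → (W) → (D) → TorusNonProliferation` — the glue, by a
  union bound over the trichotomy `{V_sf < ε n³} ∪ {ε n³ ≤ V_sf, no η-giant} ∪ {η-giant}` for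
  `n ≥ N`, and by `N_sf ≤ n³ < M` for `3 ≤ n < N`;
* `sfFewWithGiant_of_noCriticalTorusGiant : NoCriticalTorusGiant → (J)`.
No named facts are assumed.
-/

noncomputable section

namespace Summit.CriticalPhenomena.PercolationContinuityZ3.Theorems

open MeasureTheory Filter Topology Set
open Literature.Probability.Percolation Literature.Probability.LatticeModels
open Summit.CriticalPhenomena.PercolationContinuityZ3.Theses.PercTorusSliceFilling

namespace PercTorusSliceFillingTorusNonProliferation

open PercTorusSliceFillingThinClusterTransport (ncard_sliceFilling_le)

/-- **The typed split of the crux `TorusNonProliferation` (stmt-CriticalPhenomena-5415).**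
`SfFewWithGiant → SfVolumeForcesGiant → SfManyHaveVolume → TorusNonProliferation`, all three
hypotheses spelled out (they are the children (J), (W), (D) of the module docstring).
Given `δ`, take `ε, M₁` from (D) at `δ/3`, then `η, N` from (W) at `(δ/3, ε)`, then `M₂` from (J)
at `(δ/3, η)`, and `M := M₁ + M₂ + N³ + 1`.  For `3 ≤ n < N` the event `{M ≤ N_sf}` is empty
(`N_sf ≤ n³ < N³ < M`, landed `ncard_sliceFilling_le`); for `n ≥ N` it is covered by the three rare events. [folklore] -/
theorem TorusNonProliferation_of_subs
    (hJ : ∀ δ : ℝ, 0 < δ → ∀ η : ℝ, 0 < η → ∃ M : ℕ, ∀ n : ℕ, 3 ≤ n →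
      (bondPercolation (torusGraph 3 n) (criticalProbI 3)).real
        {ω | M ≤ Set.ncard {S : Set (TorusSite 3 n) | (∃ x, S = openCluster ω x) ∧
              ∃ i : Fin 3, ∀ t : ZMod n, ∃ y ∈ S, y i = t} ∧
            ∃ x : TorusSite 3 n, η * (n : ℝ) ^ 3 ≤ ((openCluster ω x).ncard : ℝ)} ≤ δ)
    (hW : ∀ δ : ℝ, 0 < δ → ∀ ε : ℝ, 0 < ε → ∃ η : ℝ, 0 < η ∧ ∃ N : ℕ, ∀ n : ℕ, N ≤ n →
      (bondPercolation (torusGraph 3 n) (criticalProbI 3)).real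
        {ω | ε * (n : ℝ) ^ 3 ≤ (Set.ncard {x : TorusSite 3 n |
              ∃ i : Fin 3, ∀ t : ZMod n, ∃ y ∈ openCluster ω x, y i = t} : ℝ) ∧
            ∀ x : TorusSite 3 n, ((openCluster ω x).ncard : ℝ) < η * (n : ℝ) ^ 3} ≤ δ)
    (hD : ∀ δ : ℝ, 0 < δ → ∃ ε : ℝ, 0 < ε ∧ ∃ M : ℕ, ∀ n : ℕ, 3 ≤ n →
      (bondPercolation (torusGraph 3 n) (criticalProbI 3)).real
        {ω | M ≤ Set.ncard {S : Set (TorusSite 3 n) | (∃ x, S = openCluster ω x) ∧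
              ∃ i : Fin 3, ∀ t : ZMod n, ∃ y ∈ S, y i = t} ∧
            (Set.ncard {x : TorusSite 3 n |
              ∃ i : Fin 3, ∀ t : ZMod n, ∃ y ∈ openCluster ω x, y i = t} : ℝ) < ε * (n : ℝ) ^ 3} ≤ δ) :
    Summit.CriticalPhenomena.PercolationContinuityZ3.Theses.PercTorusSliceFilling.TorusNonProliferation := by
  intro δ hδ
  have hδ3 : 0 < δ / 3 := by positivity
  obtain ⟨ε, hε, M₁, hM₁⟩ := hD (δ / 3) hδ3
  obtain ⟨η, hη, N, hN⟩ := hW (δ / 3) hδ3 ε hε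
  obtain ⟨M₂, hM₂⟩ := hJ (δ / 3) hδ3 η hη
  refine ⟨M₁ + M₂ + N ^ 3 + 1, fun n hn => ?_⟩
  haveI : NeZero n := ⟨by omega⟩
  set P := bondPercolation (torusGraph 3 n) (criticalProbI 3) with hP
  haveI : IsProbabilityMeasure P := by rw [hP]; infer_instance
  -- abbreviations
  set Nsf : BondConfig (TorusSite 3 n) → ℕ := fun ω => Set.ncard {S : Set (TorusSite 3 n) |
    (∃ x, S = openCluster ω x) ∧ ∃ i : Fin 3, ∀ t : ZMod n, ∃ y ∈ S, y i = t} with hNsf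
  set Vsf : BondConfig (TorusSite 3 n) → ℕ := fun ω => Set.ncard {x : TorusSite 3 n |
    ∃ i : Fin 3, ∀ t : ZMod n, ∃ y ∈ openCluster ω x, y i = t} with hVsf
  by_cases hnN : n < N
  · -- small torus: the event is empty
    have hempty : {ω : BondConfig (TorusSite 3 n) | M₁ + M₂ + N ^ 3 + 1 ≤ Nsf ω} = ∅ := by
      ext ω
      simp only [Set.mem_setOf_eq, Set.mem_empty_iff_false, iff_false, not_le]
      have h1 : Nsf ω ≤ n ^ 3 := ncard_sliceFilling_le n ω
      have h2 : n ^ 3 < N ^ 3 := Nat.pow_lt_pow_left hnN (by norm_num)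
      omega
    show P.real {ω | M₁ + M₂ + N ^ 3 + 1 ≤ Nsf ω} ≤ δ
    rw [hempty, measureReal_empty]
    exact hδ.le
  · push Not at hnN
    set A₁ : Set (BondConfig (TorusSite 3 n)) :=
      {ω | M₂ ≤ Nsf ω ∧ ∃ x : TorusSite 3 n, η * (n : ℝ) ^ 3 ≤ ((openCluster ω x).ncard : ℝ)}
      with hA₁
    set A₂ : Set (BondConfig (TorusSite 3 n)) :=
      {ω | ε * (n : ℝ) ^ 3 ≤ (Vsf ω : ℝ) ∧
        ∀ x : TorusSite 3 n, ((openCluster ω x).ncard : ℝ) < η * (n : ℝ) ^ 3} with hA₂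
    set A₃ : Set (BondConfig (TorusSite 3 n)) :=
      {ω | M₁ ≤ Nsf ω ∧ (Vsf ω : ℝ) < ε * (n : ℝ) ^ 3} with hA₃
    have hsub : {ω : BondConfig (TorusSite 3 n) | M₁ + M₂ + N ^ 3 + 1 ≤ Nsf ω} ⊆ A₃ ∪ A₂ ∪ A₁ := by
      intro ω hω
      simp only [Set.mem_setOf_eq] at hω
      by_cases hV : (Vsf ω : ℝ) < ε * (n : ℝ) ^ 3
      · exact Or.inl (Or.inl ⟨by omega, hV⟩)
      · push Not at hV
        by_cases hG : ∃ x : TorusSite 3 n, η * (n : ℝ) ^ 3 ≤ ((openCluster ω x).ncard : ℝ)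
        · exact Or.inr ⟨by omega, hG⟩
        · push Not at hG
          exact Or.inl (Or.inr ⟨hV, hG⟩)
    have h3 : P.real A₃ ≤ δ / 3 := hM₁ n hn
    have h2 : P.real A₂ ≤ δ / 3 := hN n hnN
    have h1 : P.real A₁ ≤ δ / 3 := hM₂ n hn
    show P.real {ω | M₁ + M₂ + N ^ 3 + 1 ≤ Nsf ω} ≤ δ
    calc P.real {ω | M₁ + M₂ + N ^ 3 + 1 ≤ Nsf ω}
        ≤ P.real (A₃ ∪ A₂ ∪ A₁) := measureReal_mono (μ := P) hsub
      _ ≤ P.real (A₃ ∪ A₂) + P.real A₁ := measureReal_union_le _ _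
      _ ≤ P.real A₃ + P.real A₂ + P.real A₁ :=
          add_le_add (measureReal_union_le _ _) le_rfl
      _ ≤ δ / 3 + δ / 3 + δ / 3 := add_le_add (add_le_add h3 h2) h1
      _ = δ := by ring

/-- **Child (J) is dominated by the route's other crux.** `NoCriticalTorusGiant → SfFewWithGiant`:
the event `{M ≤ N_sf ∧ ∃ x, η n³ ≤ |C(x)|}` is contained in the `η`-giant event, whose probability
tends to `0`; below the resulting threshold `N` the event `{M ≤ N_sf}` is empty for
`M = N³ + 1 > n³ ≥ N_sf`. [folklore] -/
theorem sfFewWithGiant_of_noCriticalTorusGiant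
    (h : Summit.CriticalPhenomena.PercolationContinuityZ3.Theses.PercTorusSliceFilling.NoCriticalTorusGiant) :
    ∀ δ : ℝ, 0 < δ → ∀ η : ℝ, 0 < η → ∃ M : ℕ, ∀ n : ℕ, 3 ≤ n →
      (bondPercolation (torusGraph 3 n) (criticalProbI 3)).real
        {ω | M ≤ Set.ncard {S : Set (TorusSite 3 n) | (∃ x, S = openCluster ω x) ∧
              ∃ i : Fin 3, ∀ t : ZMod n, ∃ y ∈ S, y i = t} ∧
            ∃ x : TorusSite 3 n, η * (n : ℝ) ^ 3 ≤ ((openCluster ω x).ncard : ℝ)} ≤ δ := by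
  intro δ hδ η hη
  have hev : ∀ᶠ n : ℕ in atTop, (bondPercolation (torusGraph 3 n) (criticalProbI 3)).real
      {ω | ∃ x : TorusSite 3 n, η * (n : ℝ) ^ 3 ≤ ((openCluster ω x).ncard : ℝ)} < δ :=
    (tendsto_order.1 (h η hη)).2 δ hδ
  obtain ⟨N, hN⟩ := eventually_atTop.1 hev
  refine ⟨N ^ 3 + 1, fun n hn => ?_⟩
  haveI : NeZero n := ⟨by omega⟩
  set P := bondPercolation (torusGraph 3 n) (criticalProbI 3) with hP
  haveI : IsProbabilityMeasure P := by rw [hP]; infer_instance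
  by_cases hnN : n < N
  · have hempty : {ω : BondConfig (TorusSite 3 n) | N ^ 3 + 1 ≤ Set.ncard {S : Set (TorusSite 3 n) |
        (∃ x, S = openCluster ω x) ∧ ∃ i : Fin 3, ∀ t : ZMod n, ∃ y ∈ S, y i = t} ∧
          ∃ x : TorusSite 3 n, η * (n : ℝ) ^ 3 ≤ ((openCluster ω x).ncard : ℝ)} = ∅ := by
      ext ω
      simp only [Set.mem_setOf_eq, Set.mem_empty_iff_false, iff_false, not_and]
      intro hM
      exfalso
      have h1 := ncard_sliceFilling_le n ω
      have h2 : n ^ 3 < N ^ 3 := Nat.pow_lt_pow_left hnN (by norm_num)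
      omega
    rw [hempty, measureReal_empty]
    exact hδ.le
  · push Not at hnN
    calc P.real {ω | N ^ 3 + 1 ≤ Set.ncard {S : Set (TorusSite 3 n) |
            (∃ x, S = openCluster ω x) ∧ ∃ i : Fin 3, ∀ t : ZMod n, ∃ y ∈ S, y i = t} ∧
              ∃ x : TorusSite 3 n, η * (n : ℝ) ^ 3 ≤ ((openCluster ω x).ncard : ℝ)}
        ≤ P.real {ω | ∃ x : TorusSite 3 n, η * (n : ℝ) ^ 3 ≤ ((openCluster ω x).ncard : ℝ)} :=
          measureReal_mono (μ := P) (fun ω hω => hω.2)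
      _ ≤ δ := (hN n hnN).le

end PercTorusSliceFillingTorusNonProliferation

end Summit.CriticalPhenomena.PercolationContinuityZ3.Theorems

end
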